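import Summits.ResolutionOfSingularities.ResolutionOfSingularities.Theorems.HilbertSamuelEliminationSigmaMaxModificationsCorridor3SigmaMenuStrategyCorners
import HarnessLib

/-!
# [OURS · L1 W4.2] σ-LAYER — `Corridor3SigmaMenuScheduler` (file 1/2): the DESIGN of the policy's SELECTION RULE — π₀ = OLDEST-SITE-FIRST — as a
# policy-parametric combinator `StrategyE.oldestFirst ρ κ` (functional, menu-disciplined, silent iff no oldest live site) and the FAIRNESS row type
# `NoWaitingChainWithinFromσE`; file 2/2 `…Corridor3SigmaMenuSchedulerFair` proves the ABSTRACT FAIRNESS THEOREM and the boundary AGE key's laws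
# (res-L1-w42-plan-1 RULING v3.14-18 (FI) «the DESIGN of π₀'s selection rule (fairness: isolated points and every live corner served; one functional
# centre per step)»; crux chain w42 `SigmaMaxModifications` stmt-ResolutionOfSingularities-18506 / conjunct `SigmaMaxModificationsCorridor3`
# stmt-ResolutionOfSingularities-19249; typer res-L1-type-o1 (OURS typer G4), WORD/CUT 2026-08-27T12:26:47Z; `--supports stmt-…-19249 --as helper`, counted 0)

HONEST FRAMING. OURS design + proof bookkeeping over this typer's σ-layer (`…Corridor3SigmaBoundaryDefs` p523041, `…SigmaMenuDiscipline` p526241,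
`…SigmaMenuStrategy` p527045, `…SigmaMenuStrategyCorners` p530199) and res-type-067's menu files. NOTHING here is a statement of H. Hironaka's manuscript
[Hironaka2017] nor of Cossart–Jannsen–Saito [CossartJannsenSaito2020]; no named fact is introduced; AI-typed, AI review is weaker than expert review.

## The design (one sentence)

**π₀ = OLDEST-SITE-FIRST**: CJS's own «least label first» (`IsCanonicalStepΩE`: `IsLeast {i | Y⁽ⁱ⁾ ≠ ∅} j`, [CossartJannsenSaito2020, Rem. 6.29 (1)])
extended from stratum components to MENU SITES. At a state `(W, L, P, E)` the LIVE SITES are the stratum points `x` at which a SITE-PROPOSAL relation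
`ρ` proposes some step `(C, P')` (instances, NOT in this file: the corner oracle of Track B read scheme-side at full corners; `C = menuCentre {x}` at
isolated points of `X(ν)`); each site has a KEY `κ` (for this design an AGE: the boundary age — one more than the index in `E` of the youngest boundary member through `x`,
`0` if none; §4 of file 2/2). `StrategyE.oldestFirst ρ κ` serves ONE proposal at ONE live site of LEAST key, ties broken by a fixed classical choice — so it is
FUNCTIONAL by construction (`oldestFirst_isFunctional`), disciplined by any menu containing the proposals (`oldestFirst_isDisciplinedBy`), and SILENT
exactly when no oldest live site exists (`oldestFirst_exists_step_iff`; for ages: when no site is live) — where the hybrid's fallback `τ` speaks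
(`StrategyE.hybrid`, p526241). The key type `K` is GENERIC in §1 (planner's amendment, WORD 12:33:52Z (i)): `K = ℕ` = ages (§3–§4, this design's
instance), or a lexicographic `(−ι, age)` = INVARIANT-MAX service (the other branch of the service-mode fork, CRUX-PLAN v3.12a (3)(T3)); a proposal
is a GLOBAL centre on the stage, so all sites lying on the served centre are served by the same step.

## Why it is fair (file 2/2 `…SigmaMenuSchedulerFair`, proved, scheme-free counting)

While a live site of age `k` waits, EVERY step serves a site of age `≤ k` (minimality); no site of age `≤ k` is born (newborn sites carry the new
exceptional member, whose age exceeds the boundary length, which bounds `k`); unserved sites do not split (the blow-up is injective off the centre,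
067's `injOn_compl_preimage_support`). Hence `#{live sites of age ≤ k}` drops by at least one per step while it stays `≥ 1` — impossible for ever:
`noWaitingChainWithin_live_oldestFirst_hybrid` (file 2/2, with its hypotheses (T0)–(T4) and the boundary age key `boundaryKey`).

HONEST LIMIT (RULINGS v3.14-5 (BM)(3) stands): fairness is NECESSARY, NOT sufficient for termination — oldest-first says nothing about WHICH move a
site proposes; that is `ρ`'s content (F-70 / B2 within a fan) and the Top row's; the Top third `HybridTopHyp3` is NOT claimed here (WORD 12:33:52Z (ii)).

VACUITY SELF-CHECK. `StrategyE.oldestFirst ρ κ` and `NoWaitingChainWithinFromσE` are definitions (no claim); the policy is non-trivial as soon as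
`ρ` proposes anything (`oldestFirst_exists_step_iff`), and the row type is neither trivially true (NEWEST-first policies have waiting chains whenever
births never stop) nor trivially false (file 2/2 proves it for oldest-first under (T0)–(T4)).

## Contents (namespace `…Theorems.SigmaMaxModificationsCorridor3.Sigma`)

* §1 `SiteProposal`, `SiteKey K`, `SiteProposal.union`, `IsLiveSite`, `HasLiveSite`, `IsOldestLiveSite`, `HasOldestLiveSite` (+ `.hasLiveSite`,
  `HasLiveSite.hasOldestLiveSite` for well-founded `K`, `…_of_finite` for finitely many live sites), the choices `chosenSite/chosenCentre/chosenPending`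
  + specs, **`StrategyE.oldestFirst ρ κ`**, `oldestFirst_step_iff/_step_chosen/_exists_step_iff/_step_spec`, **`oldestFirst_isFunctional`**,
  **`oldestFirst_isDisciplinedBy`**, `hybrid_oldestFirst_step_of_hasOldestLiveSite`.
* §2 `MarkedStageE.IsLiveSite ρ N ν`, the row type **`NoWaitingChainWithinFromσE σ N ν s₀ G`** (no infinite σE-chain from `s₀` inside the grade `G` whose
  marked point is never blown up), `_mono`, `_of_noWaitingChainFromσE`, `noWaitingChainFromσE_iff_within_top`, and the COVERAGE REDUCTION
  `noWaitingChainFromσE_of_within_of_eventually` (graded row + «eventually always in the grade» ⇒ (E7)'s (Live) row `NoWaitingChainFromσE`).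
* (file 2/2 `…SigmaMenuSchedulerFair`: §3 `oldestFirst_one_step`, `noWaitingChainWithin_live_oldestFirst_hybrid`; §4 `boundaryKey : SiteKey ℕ` and its
  laws (T0)/(T2-age)/(T3), `setOf_singleton_mem_componentsIn_finite`.)
-/

noncomputable section

set_option linter.dupNamespace false -- mandated namespace of this single-conjunct summit

open CategoryTheory AlgebraicGeometry TopologicalSpace
open Summit.ResolutionOfSingularities.ResolutionOfSingularities.Theorems.CampaignW42
open Literature.AlgebraicGeometry.Resolution Literature.RingTheory.HilbertSamuel

namespace Summit.ResolutionOfSingularities.ResolutionOfSingularities.Theorems.SigmaMaxModificationsCorridor3.Sigma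

universe u

/-! ## §1. Site proposals, ages, and the OLDEST-SITE-FIRST policy -/

/-- [OURS · L1 W4.2] **A SITE-PROPOSAL RELATION**: «at the state `(W, L, P, E)`, level `N`, value `ν`, the site `x` proposes the step `(C, P')`»
(instances: a corner oracle at full corners; the point itself at isolated points of `X(ν)`). NOT a statement of the manuscript. [folklore] -/
abbrev SiteProposal : Type (u + 1) :=
  ∀ (W : Scheme.{u}), IsLocallyNoetherian W → ℕ → (ℕ → ℕ) → Labelling W → Option (Pending W) → Boundary W → W →
    (C : W.IdealSheafData) → Option (Pending (blowup C)) → Prop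

/-- [OURS · L1 W4.2] **A SITE KEY** with values in `K` (a linear order in use): «age» (`K = ℕ`, instance `boundaryKey`, §4) or an invariant-first
lexicographic key `(−ι, age)` (RULING v3.14-19+ WORD 12:33:52Z (i): the combinator hosts BOTH service modes). [folklore] -/
abbrev SiteKey (K : Type) : Type (u + 1) :=
  ∀ (W : Scheme.{u}), IsLocallyNoetherian W → ℕ → (ℕ → ℕ) → Labelling W → Option (Pending W) → Boundary W → W → K

/-- [OURS · L1 W4.2] The union of two proposal relations (corners ⊔ isolated points, …). [folklore] -/
def SiteProposal.union (ρ₁ ρ₂ : SiteProposal.{u}) : SiteProposal.{u} :=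
  fun W hW N ν L P E x C P' => ρ₁ W hW N ν L P E x C P' ∨ ρ₂ W hW N ν L P E x C P'

section Sites

variable {K : Type} (ρ : SiteProposal.{u}) (κ : SiteKey.{u} K) (W : Scheme.{u}) (hW : IsLocallyNoetherian W) (N : ℕ) (ν : ℕ → ℕ)
  (L : Labelling W) (P : Option (Pending W)) (E : Boundary W)

/-- [OURS · L1 W4.2] **`x` IS A LIVE SITE** at the state: `x` lies in the `ν`-stratum and `ρ` proposes some step at `x`. [folklore] -/
def IsLiveSite (x : W) : Prop :=
  x ∈ Scheme.hsStratum W N ν ∧ ∃ (C : W.IdealSheafData) (P' : Option (Pending (blowup C))), ρ W hW N ν L P E x C P'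

/-- [OURS · L1 W4.2] Some site is live at the state `(W, L, P, E)`. [folklore] -/
def HasLiveSite (P : Option (Pending W)) (E : Boundary W) : Prop :=
  ∃ x : W, IsLiveSite ρ W hW N ν L P E x

/-- [OURS · L1 W4.2] **`x` IS AN OLDEST LIVE SITE**: live, and of LEAST key among the live sites. [folklore] -/
def IsOldestLiveSite [LE K] (x : W) : Prop :=
  IsLiveSite ρ W hW N ν L P E x ∧ ∀ y : W, IsLiveSite ρ W hW N ν L P E y → κ W hW N ν L P E x ≤ κ W hW N ν L P E y

/-- [OURS · L1 W4.2] Some OLDEST live site exists at the state (automatic for `K = ℕ`, or for finitely many live sites in a linear order; in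
general — e.g. a key unbounded below on infinitely many sites — it may fail, and then the policy is silent and the fallback speaks). [folklore] -/
def HasOldestLiveSite [LE K] (P : Option (Pending W)) (E : Boundary W) : Prop :=
  ∃ x : W, IsOldestLiveSite ρ κ W hW N ν L P E x

variable {ρ κ W hW N ν L P E}

/-- An oldest live site is live. [folklore] -/
theorem HasOldestLiveSite.hasLiveSite [LE K] (h : HasOldestLiveSite ρ κ W hW N ν L P E) : HasLiveSite ρ W hW N ν L P E :=
  let ⟨x, hx, _⟩ := h
  ⟨x, hx⟩

/-- Live sites of a union. [folklore] -/
theorem isLiveSite_union_iff {ρ₁ ρ₂ : SiteProposal.{u}} {x : W} :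
    IsLiveSite (ρ₁.union ρ₂) W hW N ν L P E x ↔ IsLiveSite ρ₁ W hW N ν L P E x ∨ IsLiveSite ρ₂ W hW N ν L P E x := by
  simp only [IsLiveSite, SiteProposal.union, exists_or, ← and_or_left]

/-- **In a WELL-FOUNDED key order (e.g. `K = ℕ`, ages) an oldest live site exists as soon as some site is live.** [folklore] -/
theorem HasLiveSite.hasOldestLiveSite [LinearOrder K] [WellFoundedLT K] (h : HasLiveSite ρ W hW N ν L P E) :
    HasOldestLiveSite ρ κ W hW N ν L P E := by
  obtain ⟨x, hx, hmin⟩ := (InvImage.wf (κ W hW N ν L P E) wellFounded_lt).has_min {y : W | IsLiveSite ρ W hW N ν L P E y} h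
  exact ⟨x, hx, fun y hy => not_lt.mp (hmin y hy)⟩

/-- **With FINITELY MANY live sites (hypothesis (T1)) an oldest live site exists in any linear key order** (the invariant-first instance). [folklore] -/
theorem HasLiveSite.hasOldestLiveSite_of_finite [LinearOrder K] (hfin : {y : W | IsLiveSite ρ W hW N ν L P E y}.Finite)
    (h : HasLiveSite ρ W hW N ν L P E) : HasOldestLiveSite ρ κ W hW N ν L P E := by
  obtain ⟨x, hx, hmin⟩ := Set.Finite.exists_minimalFor (κ W hW N ν L P E) _ hfin h
  exact ⟨x, hx, fun y hy => not_lt.mp fun hlt => hlt.ne' (le_antisymm (hmin hy hlt.le) hlt.le)⟩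

/-- [OURS · L1 W4.2] THE CHOSEN OLDEST SITE (a fixed classical choice — the tie-break of the design). [folklore] -/
def chosenSite [LE K] (h : HasOldestLiveSite ρ κ W hW N ν L P E) : W :=
  Classical.choose h

/-- The chosen site is an oldest live site. [folklore] -/
theorem chosenSite_spec [LE K] (h : HasOldestLiveSite ρ κ W hW N ν L P E) : IsOldestLiveSite ρ κ W hW N ν L P E (chosenSite h) :=
  Classical.choose_spec h

/-- [OURS · L1 W4.2] THE CHOSEN CENTRE: one proposal of `ρ` at the chosen site (classical choice). By the type of `ρ` a proposal is a GLOBAL centre `C`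
on the stage, so every site lying on `C` is served by the same step. [folklore] -/
def chosenCentre [LE K] (h : HasOldestLiveSite ρ κ W hW N ν L P E) : W.IdealSheafData :=
  Classical.choose (chosenSite_spec h).1.2

/-- [OURS · L1 W4.2] THE CHOSEN NEXT CYCLE STATE, coming with the chosen centre. [folklore] -/
def chosenPending [LE K] (h : HasOldestLiveSite ρ κ W hW N ν L P E) : Option (Pending (blowup (chosenCentre h))) :=
  Classical.choose (Classical.choose_spec (chosenSite_spec h).1.2)

/-- The chosen step is proposed by `ρ` at the chosen site. [folklore] -/
theorem chosen_proposal [LE K] (h : HasOldestLiveSite ρ κ W hW N ν L P E) :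
    ρ W hW N ν L P E (chosenSite h) (chosenCentre h) (chosenPending h) :=
  Classical.choose_spec (Classical.choose_spec (chosenSite_spec h).1.2)

end Sites

/-- [OURS · L1 W4.2] **π₀ = OLDEST-SITE-FIRST, the policy of the design**: at a state with a live site it allows EXACTLY the chosen proposal at the chosen
oldest live site; at a state without live sites it allows nothing (the hybrid's fallback speaks). One functional centre per step. NOT a statement of
the manuscript. [folklore] -/
def StrategyE.oldestFirst {K : Type} [LE K] (ρ : SiteProposal.{u}) (κ : SiteKey.{u} K) : StrategyE.{u} :=
  ⟨fun W hW N ν L P E C P' => ∃ h : HasOldestLiveSite ρ κ W hW N ν L P E, C = chosenCentre h ∧ HEq P' (chosenPending h)⟩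

section Policy

variable {K : Type} [LE K] {ρ : SiteProposal.{u}} {κ : SiteKey.{u} K} {N : ℕ} {ν : ℕ → ℕ} {W : Scheme.{u}} {hW : IsLocallyNoetherian W}
  {L : Labelling W} {P : Option (Pending W)} {E : Boundary W}

/-- Unfolding (`Iff.rfl`). [folklore] -/
theorem StrategyE.oldestFirst_step_iff {C : W.IdealSheafData} {P' : Option (Pending (blowup C))} :
    (StrategyE.oldestFirst ρ κ).step W hW N ν L P E C P' ↔
      ∃ h : HasOldestLiveSite ρ κ W hW N ν L P E, C = chosenCentre h ∧ HEq P' (chosenPending h) :=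
  Iff.rfl

/-- The chosen step is a step of the policy. [folklore] -/
theorem StrategyE.oldestFirst_step_chosen (h : HasOldestLiveSite ρ κ W hW N ν L P E) :
    (StrategyE.oldestFirst ρ κ).step W hW N ν L P E (chosenCentre h) (chosenPending h) :=
  ⟨h, rfl, HEq.rfl⟩

/-- **The policy speaks iff some OLDEST live site exists** (for ages, `K = ℕ`: iff some site is live — `HasLiveSite.hasOldestLiveSite`). [folklore] -/
theorem StrategyE.oldestFirst_exists_step_iff :
    (∃ (C : W.IdealSheafData) (P' : Option (Pending (blowup C))), (StrategyE.oldestFirst ρ κ).step W hW N ν L P E C P') ↔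
      HasOldestLiveSite ρ κ W hW N ν L P E :=
  ⟨fun ⟨_, _, h, _⟩ => h, fun h => ⟨_, _, StrategyE.oldestFirst_step_chosen h⟩⟩

/-- **Every step of the policy is a proposal at an oldest live site.** [folklore] -/
theorem StrategyE.oldestFirst_step_spec {C : W.IdealSheafData} {P' : Option (Pending (blowup C))}
    (hs : (StrategyE.oldestFirst ρ κ).step W hW N ν L P E C P') :
    ∃ x : W, IsOldestLiveSite ρ κ W hW N ν L P E x ∧ ρ W hW N ν L P E x C P' := by
  obtain ⟨h, rfl, hP⟩ := hs
  obtain rfl := eq_of_heq hP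
  exact ⟨_, chosenSite_spec h, chosen_proposal h⟩

/-- **π₀ IS FUNCTIONAL** (at every level and value): one centre, one next state. [folklore] -/
theorem StrategyE.oldestFirst_isFunctional (ρ : SiteProposal.{u}) (κ : SiteKey.{u} K) (N : ℕ) (ν : ℕ → ℕ) :
    (StrategyE.oldestFirst ρ κ).IsFunctional N ν := by
  intro W hW L P E
  refine ⟨fun C₁ C₂ P₁ P₂ h₁ h₂ => ?_, fun C P₁ P₂ h₁ h₂ => ?_⟩
  · obtain ⟨_, rfl, -⟩ := h₁
    obtain ⟨_, rfl, -⟩ := h₂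
    rfl
  · obtain ⟨_, -, hP₁⟩ := h₁
    obtain ⟨_, -, hP₂⟩ := h₂
    exact eq_of_heq (hP₁.trans hP₂.symm)

/-- **π₀ IS DISCIPLINED BY ANY MENU CONTAINING THE PROPOSALS** at stratum points (so `IsMenuDisciplinedT` for `plusMenuT`-proposals, etc.). [folklore] -/
theorem StrategyE.oldestFirst_isDisciplinedBy {M : CentreMenu.{u}}
    (hρM : ∀ (W : Scheme.{u}) (hW : IsLocallyNoetherian W) (L : Labelling W) (P : Option (Pending W)) (E : Boundary W) (x : W)
      (C : W.IdealSheafData) (P' : Option (Pending (blowup C))), x ∈ Scheme.hsStratum W N ν → ρ W hW N ν L P E x C P' → M W E N ν x C) :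
    (StrategyE.oldestFirst ρ κ).IsDisciplinedBy M N ν := by
  intro W hW L P E C P' hs
  obtain ⟨x, ⟨⟨hx, -⟩, -⟩, hρ⟩ := StrategyE.oldestFirst_step_spec hs
  exact ⟨x, hx, hρM W hW L P E x C P' hx hρ⟩

/-- **(T4) FOR MENU-VALUED PROPOSALS**: if every proposal is a Plus-menu centre at its site, proposals pass through their site (`plusMenu.mem_support`).
[folklore] -/
theorem support_of_plusMenu_proposal
    (hρ : ∀ (W : Scheme.{u}) (hW : IsLocallyNoetherian W) (L : Labelling W) (P : Option (Pending W)) (E : Boundary W) (x : W)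
      (C : W.IdealSheafData) (P' : Option (Pending (blowup C))), ρ W hW N ν L P E x C P' → plusMenu W E N ν x C)
    (W : Scheme.{u}) (hW : IsLocallyNoetherian W) (L : Labelling W) (P : Option (Pending W)) (E : Boundary W) (x : W) (C : W.IdealSheafData)
    (P' : Option (Pending (blowup C))) (h : ρ W hW N ν L P E x C P') : x ∈ (C.support : Set W) :=
  plusMenu.mem_support (hρ W hW L P E x C P' h)

/-- **At a state with an oldest live site, every step of the hybrid `π₀.hybrid τ` is a step of π₀** (the fallback is silent there). [folklore] -/
theorem StrategyE.hybrid_oldestFirst_step_of_hasOldestLiveSite {τ : StrategyE.{u}} (h : HasOldestLiveSite ρ κ W hW N ν L P E)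
    {C : W.IdealSheafData} {P' : Option (Pending (blowup C))} (hs : ((StrategyE.oldestFirst ρ κ).hybrid τ).step W hW N ν L P E C P') :
    (StrategyE.oldestFirst ρ κ).step W hW N ν L P E C P' := by
  rcases hs with hs | ⟨hno, -⟩
  · exact hs
  · exact absurd (StrategyE.oldestFirst_exists_step_iff.mpr h) hno

end Policy

/-! ## §2. The liveness grade and the fairness row type -/

/-- [OURS · L1 W4.2] The marked point of a marked E-stage is a live site (for `ρ`, at level `N`, value `ν`). [folklore] -/
def MarkedStageE.IsLiveSite (ρ : SiteProposal.{u}) (N : ℕ) (ν : ℕ → ℕ) (s : MarkedStageE.{u}) : Prop :=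
  Sigma.IsLiveSite ρ s.W s.ln N ν s.L s.P s.E s.pt

/-- Unfolding (`Iff.rfl`). [folklore] -/
theorem MarkedStageE.isLiveSite_iff (ρ : SiteProposal.{u}) (N : ℕ) (ν : ℕ → ℕ) (s : MarkedStageE.{u}) :
    s.IsLiveSite ρ N ν ↔ Sigma.IsLiveSite ρ s.W s.ln N ν s.L s.P s.E s.pt :=
  Iff.rfl

/-- [OURS · L1 W4.2] **NO WAITING σ-CHAIN WITHIN THE GRADE `G`** (boundary threaded): no infinite chain of σ-steps reached from `s₀`, inside `G` at every
stage, along which the marked point is NEVER blown up. For `G = ⊤` this is `NoWaitingChainFromσE`; for `G` = «the marked point is a live site» it is the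
FAIRNESS ROW of the design («no live site starves»). NOT a statement of the manuscript. [folklore] -/
def NoWaitingChainWithinFromσE (σ : StrategyE.{u}) (N : ℕ) (ν : ℕ → ℕ) (s₀ : MarkedStageE.{u}) (G : MarkedStageE.{u} → Prop) : Prop :=
  ¬ ∃ c : ℕ → MarkedStageE.{u}, ReachesσE σ N ν s₀ (c 0) ∧
      (∀ n, CanonicalNearStepσE σ N ν (c n) (c (n + 1))) ∧ (∀ n, G (c n)) ∧ ∀ n, ¬ (c n).IsBlownUpσE σ N ν

section Row

variable {σ : StrategyE.{u}} {N : ℕ} {ν : ℕ → ℕ} {s₀ : MarkedStageE.{u}} {G G' : MarkedStageE.{u} → Prop}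

/-- Monotonicity in the grade. [folklore] -/
theorem noWaitingChainWithinFromσE_mono (hGG' : ∀ s, G s → G' s) (h : NoWaitingChainWithinFromσE σ N ν s₀ G') :
    NoWaitingChainWithinFromσE σ N ν s₀ G :=
  fun ⟨c, h0, hstep, hG, hw⟩ => h ⟨c, h0, hstep, fun n => hGG' _ (hG n), hw⟩

/-- The unrestricted waiting row implies every graded one. [folklore] -/
theorem noWaitingChainWithinFromσE_of_noWaitingChainFromσE (h : NoWaitingChainFromσE σ N ν s₀) :
    NoWaitingChainWithinFromσE σ N ν s₀ G :=
  fun ⟨c, h0, hstep, _, hw⟩ => h ⟨c, h0, hstep, hw⟩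

/-- The unrestricted waiting row is the graded one at `⊤`. [folklore] -/
theorem noWaitingChainFromσE_iff_within_top :
    NoWaitingChainFromσE σ N ν s₀ ↔ NoWaitingChainWithinFromσE σ N ν s₀ fun _ => True :=
  ⟨noWaitingChainWithinFromσE_of_noWaitingChainFromσE, fun h ⟨c, h0, hstep, hw⟩ => h ⟨c, h0, hstep, fun _ => trivial, hw⟩⟩

/-- **COVERAGE REDUCTION FOR THE (Live) ROW**: if along every infinite σ-chain from `s₀` whose marked point is never blown up the marked point is
EVENTUALLY ALWAYS in the grade `G` (for the design: eventually always a LIVE SITE — the coverage obligation of the instances), then the graded row at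
`G` yields the unrestricted waiting row `NoWaitingChainFromσE σ N ν s₀` that (E7)'s `RowsAtσE` consumes (tails are chains from a reached stage).
[folklore] -/
theorem noWaitingChainFromσE_of_within_of_eventually (h : NoWaitingChainWithinFromσE σ N ν s₀ G)
    (hev : ∀ c : ℕ → MarkedStageE.{u}, ReachesσE σ N ν s₀ (c 0) → (∀ n, CanonicalNearStepσE σ N ν (c n) (c (n + 1))) →
      (∀ n, ¬ (c n).IsBlownUpσE σ N ν) → ∃ n₀, ∀ n, n₀ ≤ n → G (c n)) :
    NoWaitingChainFromσE σ N ν s₀ := by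
  rintro ⟨c, h0, hstep, hw⟩
  obtain ⟨n₀, hn₀⟩ := hev c h0 hstep hw
  have hreach : ∀ n, ReachesσE σ N ν s₀ (c n) := fun n => by
    induction n with
    | zero => exact h0
    | succ n ih => exact ih.tail (hstep n)
  exact h ⟨fun n => c (n₀ + n), hreach n₀, fun n => hstep (n₀ + n), fun n => hn₀ _ (Nat.le_add_right _ _), fun n => hw (n₀ + n)⟩

end Row

end Summit.ResolutionOfSingularities.ResolutionOfSingularities.Theorems.SigmaMaxModificationsCorridor3.Sigma

end
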